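import Mathlib
import HarnessLib
import Literature.Analysis.FluidPDE.ClassicalSolution
import Literature.Analysis.FluidPDE.LerayHopf
import Literature.Analysis.FluidPDE.SuitableWeak
import Literature.Analysis.FluidPDE.SelfSimilar
import Literature.Analysis.FluidPDE.SelfSimilarLiouville
import Literature.Analysis.FluidPDE.LocalTypeI
import Literature.Analysis.FluidPDE.AxisymmetricEuler

/-!
# Sketch — crux-ideate round 1, ideator 3, crux `RellichScar.SymmetricScarExists`
(stmt-NavierStokesRegularity-11718).  First lemmas of the idea cards filed from this unit.
Nothing here is proved; every `def … : Prop` must elaborate (`lean check` rc 0).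

Card `katok-closing-rdss` (Anosov–Katok closing modulo similarity):
* `ApexClass C u p G` — the route's apex class (verbatim shape of the crux's hypothesis);
* `RdssSelection` — FIRST LEMMA of the line: if a singular apex profile exists for some `C`, then a
  singular apex profile which is ROTATED DISCRETELY SELF-SIMILAR (`IsRotatedDSS c R`, `1 < c`,
  `R ∈ O(3)`) exists for some `C'` (output of the closing lemma under hyperbolic statistics);
* `RdssApexFatalOfWall` — the named wall `TypeIDSSLiouvilleConjecture` kills every such profile
  (bookkeeping: suitable + 𝐈 < ∞ + Type-I ⇒ ancient mild, measurable slices);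
* `closingLine` — the composition reaching the crux BY NAME (stated as a Prop; pure logic + Tonelli).
-/

namespace Summit.NavierStokesRegularity.NavierStokesRegularity.Theses.RellichScar.CruxIdeate11718

open MeasureTheory Set Filter

local notation "ℝ³" => EuclideanSpace ℝ (Fin 3)

/-- The route's apex class: suitable weak solution of NS (ν = 1, f = 0) on the slab ℝ³ × (−∞,0) with weak
spatial gradient `G`, Albritton–Barker quantity 𝐈 < ∞ and the space–time Type-I bound with constant `C`. -/
def ApexClass (C : ℝ) (u : ℝ → ℝ³ → ℝ³) (p : ℝ → ℝ³ → ℝ) (G : ℝ → ℝ³ → ℝ³ →L[ℝ] ℝ³) : Prop :=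
  Literature.Analysis.FluidPDE.IsSuitableWeakSolutionOn
      (Literature.Analysis.FluidPDE.slab (EuclideanSpace ℝ (Fin 3)) (Set.Iio 0) isOpen_Iio) 1 0 u p ∧
    Literature.Analysis.FluidPDE.HasWeakSpatialGradientOn
      (Literature.Analysis.FluidPDE.slab (EuclideanSpace ℝ (Fin 3)) (Set.Iio 0) isOpen_Iio) u G ∧
    Literature.Analysis.FluidPDE.typeIBound (Set.Iio (0 : ℝ) ×ˢ Set.univ) u p G < ⊤ ∧
    Literature.Analysis.FluidPDE.HasTypeIDecay C u

/-- Singular at the space–time origin (backward singular point). -/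
def Sing (u : ℝ → ℝ³ → ℝ³) : Prop :=
  Literature.Analysis.FluidPDE.IsBackwardSingularPoint u 0

/-- Hypothesis of the crux: a singular apex profile with constant `C` exists. -/
def ApexExists (C : ℝ) : Prop :=
  ∃ (u : ℝ → ℝ³ → ℝ³) (p : ℝ → ℝ³ → ℝ) (G : ℝ → ℝ³ → ℝ³ →L[ℝ] ℝ³), ApexClass C u p G ∧ Sing u

/-- FIRST LEMMA of card `katok-closing-rdss` (RDSS SELECTION): if a singular apex profile exists, then for
some constant `C'` there is a singular apex profile which is rotated discretely self-similar with some factor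
`c > 1` and some linear isometry `R` of ℝ³ — a compact orbit of the similarity group ℝ₊ × O(3) inside the
compact set of singular apex profiles (periodic orbit of the zoom flow modulo rotations), with measurable
slices and the ancient mild (duality) identity (the class of the wall `TypeIDSSLiouville`). -/
def RdssSelection : Prop :=
  ∀ C : ℝ, ApexExists C →
    ∃ (C' c : ℝ) (R : ℝ³ ≃ₗᵢ[ℝ] ℝ³) (u : ℝ → ℝ³ → ℝ³) (p : ℝ → ℝ³ → ℝ) (G : ℝ → ℝ³ → ℝ³ →L[ℝ] ℝ³),
      1 < c ∧ ApexClass C' u p G ∧ Sing u ∧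
      Literature.Analysis.FluidPDE.IsRotatedDSS c R u ∧
      Literature.Analysis.FluidPDE.IsAncientMildSolution 1 u ∧
      (∀ t < 0, AEStronglyMeasurable (u t) volume)

/-- The named wall kills RDSS singular apex profiles: under `TypeIDSSLiouvilleConjecture` (all factors, all
isometries) no profile as produced by `RdssSelection` exists (the wall gives `u t =ᵐ 0` on every slice,
Tonelli gives `uncurry u =ᵐ 0` on the slab, contradicting `Sing u`). Stated, not proved. -/
def RdssApexFatalOfWall : Prop :=
  Literature.Analysis.FluidPDE.TypeIDSSLiouvilleConjecture →
    ∀ (C' c : ℝ) (R : ℝ³ ≃ₗᵢ[ℝ] ℝ³) (u : ℝ → ℝ³ → ℝ³) (p : ℝ → ℝ³ → ℝ) (G : ℝ → ℝ³ → ℝ³ →L[ℝ] ℝ³),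
      1 < c → ApexClass C' u p G → Sing u →
      Literature.Analysis.FluidPDE.IsRotatedDSS c R u →
      Literature.Analysis.FluidPDE.IsAncientMildSolution 1 u →
      (∀ t < 0, AEStronglyMeasurable (u t) volume) → False

/-- The crux's conclusion, verbatim (symmetric-scar witness). -/
def SymScarWitness : Prop :=
  ∃ (C' : ℝ) (u : ℝ → ℝ³ → ℝ³) (p : ℝ → ℝ³ → ℝ) (G : ℝ → ℝ³ → ℝ³ →L[ℝ] ℝ³),
    Literature.Analysis.FluidPDE.IsSuitableWeakSolutionOn (Literature.Analysis.FluidPDE.slab (EuclideanSpace ℝ (Fin 3)) (Set.Iio 0) isOpen_Iio) 1 0 u p ∧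
    Literature.Analysis.FluidPDE.HasWeakSpatialGradientOn (Literature.Analysis.FluidPDE.slab (EuclideanSpace ℝ (Fin 3)) (Set.Iio 0) isOpen_Iio) u G ∧
    Literature.Analysis.FluidPDE.typeIBound (Set.Iio (0 : ℝ) ×ˢ Set.univ) u p G < ⊤ ∧
    Literature.Analysis.FluidPDE.HasTypeIDecay C' u ∧
    Literature.Analysis.FluidPDE.IsBackwardSingularPoint u 0 ∧
    ((∀ lam : ℝ, 0 < lam → (∀ K : Set ℝ³, IsCompact K → (0 : ℝ³) ∉ K →
        Filter.Tendsto (fun δ : ℝ => MeasureTheory.eLpNorm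
          (Function.uncurry (Literature.Analysis.FluidPDE.nsRescale lam u) - Function.uncurry u) ⊤
          (MeasureTheory.volume.restrict (Set.Ioo (-δ) 0 ×ˢ K))) (nhdsWithin 0 (Set.Ioi 0)) (nhds 0))) ∨
     (∀ θ : ℝ, (∀ K : Set ℝ³, IsCompact K → (0 : ℝ³) ∉ K →
        Filter.Tendsto (fun δ : ℝ => MeasureTheory.eLpNorm
          (Function.uncurry (fun t x => Literature.Analysis.FluidPDE.rotZ θ (u t (Literature.Analysis.FluidPDE.rotZ (-θ) x))) - Function.uncurry u) ⊤
          (MeasureTheory.volume.restrict (Set.Ioo (-δ) 0 ×ˢ K))) (nhdsWithin 0 (Set.Ioi 0)) (nhds 0))))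

/-- The crux `SymmetricScarExists`, verbatim shape: `∀ C, ApexExists C → SymScarWitness`. -/
def CruxShape : Prop := ∀ C : ℝ, ApexExists C → SymScarWitness

/-- COMPOSITION of the line (pure logic): RDSS selection + the named wall ⇒ no apex profile ⇒ the crux
(vacuously in its hypothesis). -/
def closingLine : Prop :=
  RdssSelection → RdssApexFatalOfWall → Literature.Analysis.FluidPDE.TypeIDSSLiouvilleConjecture → CruxShape

/-- The composition is indeed pure logic. -/
theorem closingLine_holds : closingLine := by
  intro hSel hFatal hWall C hC
  obtain ⟨C', c, R, u, p, G, hc, hA, hS, hR, hM, hmeas⟩ := hSel C hC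
  exact (hFatal hWall C' c R u p G hc hA hS hR hM hmeas).elim

/-- UNCONDITIONAL CORNER (no conjecture): if the selected RDSS profile is untwisted with factor below the
Chae–Wolf/Pineau–Vicol threshold, the proved facts `chaeWolf2017_removing_dss` / `pineauVicol2026_rdss_liouville`
kill it. Recorded as the shape of the statement a prover would target for FAST-recurrent hyperbolic statistics. -/
def FastRdssSelection (cmax : ℝ → ℝ) : Prop :=
  ∀ C : ℝ, ApexExists C →
    ∃ (C' c : ℝ) (u : ℝ → ℝ³ → ℝ³) (p : ℝ → ℝ³ → ℝ) (G : ℝ → ℝ³ → ℝ³ →L[ℝ] ℝ³),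
      1 < c ∧ c < cmax C' ∧ ApexClass C' u p G ∧ Sing u ∧
      Literature.Analysis.FluidPDE.IsDiscretelySelfSimilar c u

/-- P4 of card `katok-closing-rdss` ("robust Chae–Wolf", finite-lag companion of Pineau–Vicol's one-slice
theorem): below the Chae–Wolf threshold `c₁(C)` no singular apex profile returns `δ₁`-close to its own
untwisted `c`-rescaling on the unit backward parabolic window, uniformly for `c` in a compact lag range.
Provable-now shape: `δₙ → 0` + SuitableCompactness/Persistence ⇒ an exact `c`-DSS singular apex profile with
`1 < c < c₁`, excluded by `chaeWolf2017_removing_dss` (after smooth-representative bookkeeping). -/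
def RobustChaeWolf : Prop :=
  ∀ C : ℝ, 0 < C → ∃ c₁ : ℝ, 1 < c₁ ∧ ∀ lam₁ lam₂ : ℝ, 1 < lam₁ → lam₁ ≤ lam₂ → lam₂ < c₁ →
    ∃ δ₁ : ℝ, 0 < δ₁ ∧
      ∀ (u : ℝ → ℝ³ → ℝ³) (p : ℝ → ℝ³ → ℝ) (G : ℝ → ℝ³ → ℝ³ →L[ℝ] ℝ³), ApexClass C u p G → Sing u →
        ∀ lam : ℝ, lam₁ ≤ lam → lam ≤ lam₂ →
          ENNReal.ofReal δ₁ <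
            eLpNorm (fun z : ℝ × ℝ³ => (‖z.2‖ + Real.sqrt (-z.1)) •
                (u z.1 z.2 - Literature.Analysis.FluidPDE.nsRescale lam u z.1 z.2)) ⊤
              (volume.restrict (Set.Ioo (-1 : ℝ) 0 ×ˢ Metric.ball (0 : ℝ³) 1))

end Summit.NavierStokesRegularity.NavierStokesRegularity.Theses.RellichScar.CruxIdeate11718
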